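import Mathlib
import Literature.Probability.LatticeModels.SourcedCurrentLaw
import Literature.Probability.LatticeModels.AizenmanGrahamInequality
import Literature.Probability.LatticeModels.IsingThermodynamics
import Summits.CriticalPhenomena.Ising3DConformalLimit.Theses.PerfectScreening
import Summits.CriticalPhenomena.Ising3DConformalLimit.Cruxes.IsingEuclidUpgradeR4NonGaussian.Disproof

/-!
# Sketch — crux-ideate stmt-CriticalPhenomena-13885 (`CoulombImpliesNontrivial`), ideator k = 2, round 1

First lemmas of the two idea cards, stated over existing declarations (they need not be proved here):

* card `excess-current-energy-transparency`: `ExcessCurrentInequality` (finite graph, any `β ≤ 1`),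
  its summed form `MeanClusterSizeLowerBound`, the residual crux `EnergyTransparent` and the transfer
  `TransparencyTransfer : Coulomb → (transparency at infinitely many scales) → LatticeU4RatioPositiveSeq`
  (the ρ-free lattice target of the sibling disproof file, which implies crux 0636 and hence this crux).
* card `critical-window-sum-rule`: `CriticalWindowDrop` and `CriticalWindowSlope` (pure two-point /
  susceptibility statements on `ℤ³`).
-/

noncomputable section

namespace Summit.CriticalPhenomena.Ising3DConformalLimit.Cruxes.CoulombImpliesNontrivial.IdeatorK2

open MeasureTheory Filter Finset
open Literature.Probability.LatticeModels
open Literature.Probability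

/-! ## Card A — the excess-current inequality (finite graphs) -/

section Excess

variable {V : Type*} [Fintype V] [DecidableEq V] (G : SimpleGraph V) [DecidableRel G.Adj]

/-- The edge `{y,z}` of `G` as an element of `G.edgeFinset`. -/
def edgeOf {y z : V} (h : G.Adj y z) : G.edgeFinset :=
  ⟨s(y, z), by rw [SimpleGraph.mem_edgeFinset]; exact h⟩

/-- The event "the edge `{y,z}` carries positive current AND `y` is connected to the source `a` in the
trace of `n`" (single current). -/
def excessEvent (a y z : V) (h : G.Adj y z) : Set (Current G) :=
  {n | 0 < n (edgeOf G h) ∧ n.traced ∈ Percolation.openConn a y}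

/-- **FIRST LEMMA (card A): the EXCESS-CURRENT INEQUALITY.** For the random current `𝐏^{ab}_{G,β}`
with sources `{a,b}` on a finite graph (uniform coupling `β ∈ (0,1]`, free b.c., zero field) and every
edge `{y,z}`:
`(β/3)·⟨σ_yσ_z ; σ_aσ_b⟩ ≤ ⟨σ_aσ_b⟩ · 𝐏^{ab}[n_{yz} ≥ 1 ∧ y ⟷ a]`.
Proof sketch (NOTES.md "Lever A"): `E^{ab}[n_e] − E^∅[n_e] = β⟨σ_yσ_z;σ_aσ_b⟩/⟨σ_aσ_b⟩` (β-derivative of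
`log (Z⟨σ_aσ_b⟩)` and of `log Z`); conditioning on the cluster `C` of `a`, the current off `C` is a
sourceless current on `G[V∖C]` whose mean flux through `e` is `β⟨σ_yσ_z⟩_{G[V∖C]} ≤ β⟨σ_yσ_z⟩_G`
(Griffiths II), so the whole excess is carried by `{y ⟷ a}`; finally `E[n_e 1_E] ≤ C'(β) 𝐏[n_e ≥ 1, E]`
with `C'(β) = max(β coth β, β sinh β/(cosh β − 1)) ≤ 2.2 < 3` for `β ≤ 1` (the bijection `n ↦ n ± 2δ_e`
preserves openness). -/
def ExcessCurrentInequality : Prop :=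
  ∀ (β : ℝ), 0 < β → β ≤ 1 → ∀ (a b y z : V), a ≠ b → ∀ (h : G.Adj y z),
    (β / 3) * isingPairCov G Finset.univ β 0 .free y z a b ≤
      isingTwoPoint G Finset.univ β 0 .free a b * (currentLaw G β {a, b}).real (excessEvent G a y z h)

/-- The mean size of the cluster of the source `a` under `𝐏^{ab}_{G,β}`: `∑_v 𝐏^{ab}[v ⟷ a]`. -/
def meanClusterSize (β : ℝ) (a b : V) : ℝ :=
  ∑ v : V, (currentLaw G β {a, b}).real {n | n.traced ∈ Percolation.openConn a v}

/-- **Summed form (card A / input of card B):** the mean single-current cluster size is at least the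
temperature sensitivity of the two-point function,
`∑_v 𝐏^{ab}[v ⟷ a] ≥ (β/(3·Δ_G)) · ∑_{y∼z} ⟨σ_yσ_z;σ_aσ_b⟩ / ⟨σ_aσ_b⟩`, `Δ_G` the maximal degree
(each `v` is the endpoint `y` of at most `Δ_G` ordered edges). With `∑_{y∼z}⟨σ_yσ_z;σ_aσ_b⟩ = 2∂_β⟨σ_aσ_b⟩`
this reads `E^{ab}|C(a)| ≥ (2β/(3Δ_G)) ∂_β log⟨σ_aσ_b⟩`. -/
def MeanClusterSizeLowerBound : Prop :=
  ∀ (β : ℝ), 0 < β → β ≤ 1 → ∀ (a b : V), a ≠ b →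
    0 < isingTwoPoint G Finset.univ β 0 .free a b →
    (β / (3 * (G.maxDegree : ℝ))) *
        (∑ y : V, ∑ z : V, if G.Adj y z then isingPairCov G Finset.univ β 0 .free y z a b else 0) /
          isingTwoPoint G Finset.univ β 0 .free a b
      ≤ meanClusterSize G β a b

end Excess

/-! ## Card A — the residual crux (energy transparency) and the transfer -/

/-- The Coulomb antecedent of the crux (same as `…Disproof.Coulomb`). -/
def Coulomb : Prop :=
  ∃ c : ℝ, 0 < c ∧ ∀ x : Site 3, x ≠ 0 → c / ‖x‖ ≤ criticalTwoPoint 3 x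

/-- The truncated pair–pair function of the critical state at the pinched quadruple
`(0, R e₀ ; y, y + e_i)`: `⟨σ₀σ_{Re₀}σ_yσ_{y+e_i}⟩_{β_c} − ⟨σ₀σ_{Re₀}⟩⟨σ_yσ_{y+e_i}⟩`. -/
def pinchedCov (R : ℕ) (y : Site 3) (i : Fin 3) : ℝ :=
  criticalCorr 3 4 ![0, Pi.single 0 (R : ℤ), y, y + Pi.single i 1] -
    criticalTwoPoint 3 (Pi.single 0 (R : ℤ)) * criticalTwoPoint 3 (Pi.single i 1)

/-- The Lebowitz (free) value at the same pinched quadruple: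
`G(y)G(Re₀ − y − e_i) + G(y + e_i)G(Re₀ − y)`. -/
def lebowitzValue (R : ℕ) (y : Site 3) (i : Fin 3) : ℝ :=
  criticalTwoPoint 3 y * criticalTwoPoint 3 (Pi.single 0 (R : ℤ) - y - Pi.single i 1) +
    criticalTwoPoint 3 (y + Pi.single i 1) * criticalTwoPoint 3 (Pi.single 0 (R : ℤ) - y)

/-- The middle box between the sources `0` and `R e₀`: sites `y` with `|y₀ − R/2| ≤ R/4`, `|y₁|,|y₂| ≤ R/4`. -/
def middleBox (R : ℕ) : Finset (Site 3) :=
  Finset.Icc (fun j : Fin 3 => if j = 0 then (R : ℤ) / 2 - (R : ℤ) / 4 else -((R : ℤ) / 4))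
    (fun j : Fin 3 => if j = 0 then (R : ℤ) / 2 + (R : ℤ) / 4 else (R : ℤ) / 4)

/-- **ENERGY TRANSPARENCY at scale `R` (card A's residual crux, the antecedent of the transfer).**
A fraction `θ` of the sites of the middle box are `c'`-transparent: the energy response of the pair
`σ₀σ_{Re₀}` at `y` is at least `c'` times its Lebowitz bound (summed over the three positive directions). -/
def EnergyTransparent (c' θ : ℝ) (R : ℕ) : Prop :=
  θ * ((middleBox R).card : ℝ) ≤
    (((middleBox R).filter fun y =>
        c' * ∑ i : Fin 3, lebowitzValue R y i ≤ ∑ i : Fin 3, pinchedCov R y i).card : ℝ)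

/-- **TRANSFER (card A): `C⁺ → crux`.** Under Coulomb, transparency at infinitely many scales gives the
ρ-free lattice target `LatticeU4RatioPositiveSeq` of the sibling disproof file (crux 0636, §C), hence
crux 0636 (`of_latticeU4RatioPositiveSeq`), hence `CoulombImpliesNontrivial` (`crux_iff` of this crux's
Disproof.lean). Engine: excess-current inequality ⇒ single clusters have density `≥ c″K` on the
transparent sites ⇒ first moment `≍ R`; second moment `≤ CR²` by the double-current chain bound (free under
Coulomb); Paley–Zygmund at the quadruple `(0, e₀, v, v + e₀)·R` for a positive-fraction set of `v`. -/
def TransparencyTransfer : Prop :=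
  Coulomb → (∃ c' θ : ℝ, 0 < c' ∧ 0 < θ ∧ ∃ᶠ R : ℕ in atTop, EnergyTransparent c' θ R) →
    Summit.CriticalPhenomena.Ising3DConformalLimit.Cruxes.IsingEuclidUpgradeR4NonGaussian.Disproof.LatticeU4RatioPositiveSeq

/-- The residual crux of card A: Coulomb forces energy transparency at infinitely many scales
("`Δ_σ = 1/2` forces a free-like `σσε` response"). -/
def CoulombImpliesTransparency : Prop :=
  Coulomb → ∃ c' θ : ℝ, 0 < c' ∧ 0 < θ ∧ ∃ᶠ R : ℕ in atTop, EnergyTransparent c' θ R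

/-- The two halves compose to the crux (pure logic + the two sibling theorems quoted above). -/
theorem crux_of_transparency
    (hT : TransparencyTransfer) (hC : CoulombImpliesTransparency)
    (hSib : Summit.CriticalPhenomena.Ising3DConformalLimit.Cruxes.IsingEuclidUpgradeR4NonGaussian.Disproof.LatticeU4RatioPositiveSeq →
      Summit.CriticalPhenomena.Ising3DConformalLimit.Theses.IsingEuclidUpgrade.IsingEuclidUpgradeR4NonGaussian) :
    Summit.CriticalPhenomena.Ising3DConformalLimit.Theses.PerfectScreening.CoulombImpliesNontrivial := by
  intro hCoul ρ S hρ hlim hnd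
  exact hSib (hT hCoul (hC hCoul)) ρ S hρ hlim hnd

/-- The quoted sibling theorem exists (so `hSib` above is dischargeable by name). -/
example : Summit.CriticalPhenomena.Ising3DConformalLimit.Cruxes.IsingEuclidUpgradeR4NonGaussian.Disproof.LatticeU4RatioPositiveSeq →
    Summit.CriticalPhenomena.Ising3DConformalLimit.Theses.IsingEuclidUpgrade.IsingEuclidUpgradeR4NonGaussian :=
  Summit.CriticalPhenomena.Ising3DConformalLimit.Cruxes.IsingEuclidUpgradeR4NonGaussian.Disproof.of_latticeU4RatioPositiveSeq

/-! ## Card B — the critical-window sum rule (pure two-point statements on `ℤ³`) -/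

/-- Mean-field susceptibility amplitude below `β_c`: `χ(β) ≤ C/(β_c − β)` on `[β₀, β_c)`
("`γ ≤ 1` with amplitude `C`"; true iff the bulk Lebowitz sum rule is unsaturated, NOTES "Lever B"). -/
def SusceptibilityMeanFieldUpper (C β₀ : ℝ) : Prop :=
  ∀ β : ℝ, β₀ ≤ β → β < criticalBeta 3 →
    susceptibility 3 β ≤ ENNReal.ofReal (C / (criticalBeta 3 - β))

/-- **FIRST LEMMA (card B): the CRITICAL-WINDOW DROP.** Coulomb at `β_c` and a mean-field
susceptibility amplitude force the axial two-point function at distance `R` to lose half its value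
already at `β_c − τ_R`, `τ_R = 54C/(cR²)`: by Messager–Miracle-Solé `G_β(y) ≥ G_β(Re₀)` for
`‖y‖_∞ ≤ R/3`, so `(R/3)³ G_β(Re₀) ≤ χ(β) ≤ C/τ_R`, while `G_{β_c}(Re₀) ≥ c/R`. -/
def CriticalWindowDrop : Prop :=
  ∀ c C β₀ : ℝ, 0 < c → 0 < C → β₀ < criticalBeta 3 →
    (∀ x : Site 3, x ≠ 0 → c / ‖x‖ ≤ criticalTwoPoint 3 x) →
    SusceptibilityMeanFieldUpper C β₀ →
    ∃ R₀ : ℕ, ∀ R : ℕ, R₀ ≤ R →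
      twoPointFree 3 (criticalBeta 3 - 54 * C / (c * (R : ℝ) ^ 2)) (Pi.single 0 (R : ℤ)) ≤
        (1 / 2) * criticalTwoPoint 3 (Pi.single 0 (R : ℤ))

/-- **Mean-value form (card B): somewhere in the window the energy response is of free order `R`.**
There are `β₁ < β₂` in `[β_c − τ_R, β_c]` across which the axial two-point function at distance `R`
climbs with average slope `≥ c' R` (`c' = c²/(108 C)`); by `∂_β⟨σ₀σ_x⟩ = ∑_{y∼z}⟨σ_yσ_z;σ₀σ_x⟩` and the
summed excess-current inequality this is mean fatness `E|C_single| ≳ R²` of the sourced cluster at a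
near-critical `β*` — the single-cluster analogue of the double-cluster mass `∑_u K(u) ≍ R²`. -/
def CriticalWindowSlope : Prop :=
  ∀ c C β₀ : ℝ, 0 < c → 0 < C → β₀ < criticalBeta 3 →
    (∀ x : Site 3, x ≠ 0 → c / ‖x‖ ≤ criticalTwoPoint 3 x) →
    SusceptibilityMeanFieldUpper C β₀ →
    ∃ R₀ : ℕ, ∀ R : ℕ, R₀ ≤ R → ∃ β₁ β₂ : ℝ,
      criticalBeta 3 - 54 * C / (c * (R : ℝ) ^ 2) ≤ β₁ ∧ β₁ < β₂ ∧ β₂ ≤ criticalBeta 3 ∧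
      (c ^ 2 / (108 * C)) * R * (β₂ - β₁) ≤
        twoPointFree 3 β₂ (Pi.single 0 (R : ℤ)) - twoPointFree 3 β₁ (Pi.single 0 (R : ℤ))

end Summit.CriticalPhenomena.Ising3DConformalLimit.Cruxes.CoulombImpliesNontrivial.IdeatorK2

end
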